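import Literature.Probability.RandomPlanarGeometry.SelfAvoidingWalk
import Literature.Probability.Process.FibreCondExp
import Mathlib.Combinatorics.SimpleGraph.Walk.Decomp
import Mathlib.Probability.Process.HittingTime
import HarnessLib

/-!
# The exploration filtration of the self-avoiding walk: prefixes, cylinders, Doob martingales

Topic `Literature/Probability/RandomPlanarGeometry`; theorems only. The combinatorial and
measure-theoretic plumbing of "`𝓕_n` = the σ-algebra generated by the first `n` steps of the
walk" on the (finite, discrete) space `SAW.DomainSAW Ω δ a b` of self-avoiding walks of a
discrete domain, in the shape consumed by the passage of DISCRETE Doob martingales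
`E_δ[X ∣ γ[0,n]]` to scaling limits (Duminil-Copin–Smirnov, Clay Math. Proc. 15 (2012),
Lemma 6.6 and proof of Prop. 6.7; Chelkak–Duminil-Copin–Hongler–Kemppainen–Smirnov, C. R. Math.
352 (2014), §3; for the SAW: Lawler–Schramm–Werner, Proc. Sympos. Pure Math. 72 (2004), §3.4).

Prefixes. The past `γ[0,n]` of a walk `γ` is `γ.walk.takeUntil (γ.walk.getVert n) _` (the whole
walk once `n ≥ |γ|`); its support is `γ.support.take (n+1)` (`support_takeUntil_getVert`), so
pasts are nested (`support_takeUntil_getVert_eq_of_le`), exhaust the walk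
(`support_takeUntil_getVert_of_length_le`) and determine it (`eq_of_support_takeUntil_getVert_eq`);
functionals of walks that only see the support agree on walks with equal supports
(`apply_eq_of_support_eq`); and the CYLINDER `{γ' | γ'.takeUntil w = γ[0,n]}` of a past (the event
conditioned on in `E_δ[· ∣ γ[0,n]]`) is the fibre of `γ' ↦ support γ'[0,n]`
(`setOf_takeUntil_eq_eq_fibre`).

The exploration package `exists_explorationFiltration`: for a prefix-determined real "clock"
`c γ n` (e.g. the half-plane capacity of the past) and two levels `s ≤ t`, a filtration `𝒢` on
`ℕ` (generated by the supports of the pasts), a bound `M` on all lengths, the first passage indices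
`σ ≤ τ ≤ M` of the clock above `s`, `t` as `𝒢`-stopping times, with: the measurability criterion
for `𝒢 n` (prefix-determined maps), **the Doob identity** (for every finite measure `μ` and every
`X`, `μ[X ∣ 𝒢 n]` is a.e. the cylinder average `(∫_{cyl} X dμ)/μ(cyl)`), the pathwise description
of `σ, τ` (first index of clock `≥` level, none before), and the measurability criterion for the
stopped σ-algebra `𝒢_σ` (maps determined by the past up to `σ` on `{σ < M}`).

No definitions, no named facts.

## References

* H. Duminil-Copin, S. Smirnov, *Conformal invariance of lattice models*, Clay Math. Proc. 15
  (2012), Lemma 6.6, proof of Prop. 6.7.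
* D. Chelkak, H. Duminil-Copin, C. Hongler, A. Kemppainen, S. Smirnov, C. R. Math. 352 (2014), §3.
* G. F. Lawler, O. Schramm, W. Werner, Proc. Sympos. Pure Math. 72 (2004), §3.4.
-/

noncomputable section

open MeasureTheory Filter Set
open scoped ENNReal NNReal Classical
open Literature.Probability.LatticeModels (Site discreteDomainGraph)
open Literature.Probability.Process

namespace Literature.Probability.RandomPlanarGeometry.SAW

/-! ### Walks with equal supports; prefixes of a path -/

section Walks

variable {V : Type*} {G : SimpleGraph V} {u v v' : V}

/-- **A functional of walks from `u` that factors through the support**: walks from `u` with the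
same support have the same endpoint and are equal, so every `F` agrees on them. [folklore] -/
theorem apply_eq_of_support_eq {β : Sort*} (F : ∀ w : V, G.Walk u w → β) {p : G.Walk u v}
    {q : G.Walk u v'} (h : p.support = q.support) : F v p = F v' q := by
  have hv : v = v' := by
    rw [← p.getLast_support, ← q.getLast_support]
    congr 1
  subst hv
  rw [SimpleGraph.Walk.ext_support h]

variable [DecidableEq V]

/-- **The support of the past `p[0, n]`** (the prefix `takeUntil` of the `n`-th vertex of a path,
the whole path when `n ≥ |p|`) is `p.support.take (n + 1)`. [folklore] -/
theorem support_takeUntil_getVert {p : G.Walk u v} (hp : p.IsPath) (n : ℕ) :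
    (p.takeUntil (p.getVert n) (p.getVert_mem_support n)).support = p.support.take (n + 1) := by
  rw [SimpleGraph.Walk.takeUntil_eq_take, SimpleGraph.Walk.support_copy,
    SimpleGraph.Walk.support_take, List.take_eq_take_iff, SimpleGraph.Walk.length_support]
  have hidx : p.support.idxOf (p.getVert n) = min n p.length := by
    have hle : min n p.length ≤ p.length := min_le_right _ _
    have hget : p.getVert n = p.getVert (min n p.length) := by
      rcases le_total n p.length with h | h
      · rw [min_eq_left h]
      · rw [min_eq_right h, p.getVert_of_length_le h, p.getVert_length]
    rw [hget, p.getVert_eq_support_getElem hle]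
    exact hp.support_nodup.idxOf_getElem _ _
  rw [hidx]
  rcases le_total n p.length with h | h
  · rw [min_eq_left h]
  · rw [min_eq_right h]
    omega

/-- Pasts are nested: equal pasts at step `n` have equal pasts at every step `k ≤ n`.
[folklore] -/
theorem support_takeUntil_getVert_eq_of_le {p : G.Walk u v} {q : G.Walk u v'} (hp : p.IsPath)
    (hq : q.IsPath) {k n : ℕ} (hkn : k ≤ n)
    (h : (p.takeUntil (p.getVert n) (p.getVert_mem_support n)).support =
      (q.takeUntil (q.getVert n) (q.getVert_mem_support n)).support) :
    (p.takeUntil (p.getVert k) (p.getVert_mem_support k)).support =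
      (q.takeUntil (q.getVert k) (q.getVert_mem_support k)).support := by
  rw [support_takeUntil_getVert hp, support_takeUntil_getVert hq] at h ⊢
  have hmin : min (k + 1) (n + 1) = k + 1 := min_eq_left (by omega)
  rw [← hmin, ← List.take_take, h, List.take_take]

/-- The past at a step `n ≥ |p|` is the whole path. [folklore] -/
theorem support_takeUntil_getVert_of_length_le {p : G.Walk u v} (hp : p.IsPath) {n : ℕ}
    (hn : p.length ≤ n) :
    (p.takeUntil (p.getVert n) (p.getVert_mem_support n)).support = p.support := by
  rw [support_takeUntil_getVert hp, List.take_of_length_le]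
  rw [SimpleGraph.Walk.length_support]
  omega

/-- Two paths with the same endpoints and the same past at a step beyond both lengths are equal.
[folklore] -/
theorem eq_of_support_takeUntil_getVert_eq {p q : G.Walk u v} (hp : p.IsPath) (hq : q.IsPath)
    {n : ℕ} (hpn : p.length ≤ n) (hqn : q.length ≤ n)
    (h : (p.takeUntil (p.getVert n) (p.getVert_mem_support n)).support =
      (q.takeUntil (q.getVert n) (q.getVert_mem_support n)).support) : p = q := by
  rw [support_takeUntil_getVert_of_length_le hp hpn,
    support_takeUntil_getVert_of_length_le hq hqn] at h
  exact SimpleGraph.Walk.ext_support h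

/-- `takeUntil` at a vertex propositionally equal to `getVert n` is the past `p[0,n]`, cast.
[folklore] -/
theorem takeUntil_eq_copy_of_getVert_eq (p : G.Walk u v) {n : ℕ} {w : V} (hw : p.getVert n = w)
    (hmem : w ∈ p.support) :
    p.takeUntil w hmem = (p.takeUntil (p.getVert n) (p.getVert_mem_support n)).copy rfl hw := by
  subst hw
  rfl

/-- **The cylinder of a past is a fibre of the past map.** For paths `p₀ : u → v₀`, `p : u → v`
with the same END CONVENTION (`v₀`, `v` occur only at the end — automatic for paths) and a step
`n`: `p` passes through `w := p₀.getVert n` with `p.takeUntil w = p₀[0,n]` iff the pasts `p[0,n]`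
and `p₀[0,n]` have the same support — provided that, when `n` exceeds `|p₀|`, the endpoint `v₀`
of `p₀` can only be the endpoint of `p` (hypothesis `hend`, automatic when `v = v₀`). [folklore] -/
theorem exists_takeUntil_eq_iff {v₀ : V} {p₀ : G.Walk u v₀} {p : G.Walk u v} (hp₀ : p₀.IsPath)
    (hp : p.IsPath) (hend : v₀ ∈ p.support → v₀ = v) (n : ℕ) :
    (∃ hw : p₀.getVert n ∈ p.support,
        p.takeUntil (p₀.getVert n) hw = p₀.takeUntil (p₀.getVert n) (p₀.getVert_mem_support n)) ↔
      (p.takeUntil (p.getVert n) (p.getVert_mem_support n)).support =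
        (p₀.takeUntil (p₀.getVert n) (p₀.getVert_mem_support n)).support := by
  constructor
  · rintro ⟨hw, heq⟩
    -- the length of the common prefix
    have hlen : (p.takeUntil (p₀.getVert n) hw).length = min n p₀.length := by
      rw [heq, SimpleGraph.Walk.length_takeUntil]
      have hle : min n p₀.length ≤ p₀.length := min_le_right _ _
      have hget : p₀.getVert n = p₀.getVert (min n p₀.length) := by
        rcases le_total n p₀.length with h | h
        · rw [min_eq_left h]
        · rw [min_eq_right h, p₀.getVert_of_length_le h, p₀.getVert_length]
      rw [hget, p₀.getVert_eq_support_getElem hle]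
      exact hp₀.support_nodup.idxOf_getElem _ _
    -- so `p.getVert (min n |p₀|) = p₀.getVert n`
    have hvert : p.getVert (min n p₀.length) = p₀.getVert n := by
      rw [← hlen]
      exact p.getVert_length_takeUntil hw
    have hsupp := congrArg SimpleGraph.Walk.support heq
    rcases le_total n p₀.length with h | h
    · rw [min_eq_left h] at hvert
      rw [takeUntil_eq_copy_of_getVert_eq p hvert hw, SimpleGraph.Walk.support_copy] at hsupp
      exact hsupp
    · -- `n ≥ |p₀|`: then `p₀.getVert n = v₀` is the endpoint of `p`, and `p = p₀` up to cast
      have hv₀ : p₀.getVert n = v₀ := p₀.getVert_of_length_le h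
      have hvv : v₀ = v := hend (hv₀ ▸ hw)
      subst hvv
      rw [min_eq_right h] at hvert
      -- `p.getVert |p₀| = v₀ = p.getVert |p|`, injectivity of `getVert` on a path
      have hplen : p.length = p₀.length := by
        by_contra hne
        rcases Nat.lt_or_gt_of_ne hne with hlt | hgt
        · -- |p| < |p₀|: the prefix of `p` of length `min n |p₀| = |p₀|` is too long
          have := p.length_takeUntil_le_length hw
          rw [hlen, min_eq_right h] at this
          omega
        · have h1 : p.getVert p₀.length = p.getVert p.length := by
            rw [hvert, hv₀, p.getVert_length]
          have := hp.getVert_injOn (by simpa using hgt.le) (by simp) h1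
          omega
      rw [support_takeUntil_getVert_of_length_le hp (hplen ▸ h),
        support_takeUntil_getVert_of_length_le hp₀ h]
      rw [takeUntil_eq_copy_of_getVert_eq p hvert hw, SimpleGraph.Walk.support_copy,
        support_takeUntil_getVert_of_length_le hp hplen.le,
        support_takeUntil_getVert_of_length_le hp₀ h] at hsupp
      exact hsupp
  · intro h
    have hvert : p.getVert n = p₀.getVert n := by
      have h1 := (p.takeUntil (p.getVert n) (p.getVert_mem_support n)).getLast_support
      have h2 := (p₀.takeUntil (p₀.getVert n) (p₀.getVert_mem_support n)).getLast_support
      rw [← h1, ← h2]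
      congr 1
    refine ⟨hvert ▸ p.getVert_mem_support n, ?_⟩
    rw [takeUntil_eq_copy_of_getVert_eq p hvert]
    apply SimpleGraph.Walk.ext_support
    rw [SimpleGraph.Walk.support_copy, h]

end Walks

/-! ### Self-avoiding walks of a discrete domain: pasts, cylinders, the exploration package -/

section SAWs

variable {Ω : Set ℂ} {δ : ℝ} {a b : Site 2}

/-- Two self-avoiding walks with the same past at a step beyond both lengths are equal.
[folklore] -/
theorem DomainSAW.eq_of_support_takeUntil_eq {γ γ' : DomainSAW Ω δ a b} {n : ℕ}
    (hn : γ.walk.length ≤ n) (hn' : γ'.walk.length ≤ n)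
    (h : (γ.walk.takeUntil (γ.walk.getVert n) (γ.walk.getVert_mem_support n)).support =
      (γ'.walk.takeUntil (γ'.walk.getVert n) (γ'.walk.getVert_mem_support n)).support) :
    γ = γ' := by
  obtain ⟨w, hw⟩ := γ
  obtain ⟨w', hw'⟩ := γ'
  have hww : w = w' := eq_of_support_takeUntil_getVert_eq hw hw' hn hn' h
  subst hww
  rfl

/-- **The cylinder of the past `γ[0,n]` is the fibre of the past-support map**: a SAW `γ'` (same
endpoints) passes through `w = γ_n` with `γ'.takeUntil w = γ[0,n]` iff `γ'[0,n]` and `γ[0,n]`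
have the same support. The left-hand side is literally the event conditioned on in the
"expected terminal value given the past" of the SAW exploration. [folklore] -/
theorem DomainSAW.setOf_exists_takeUntil_eq (γ : DomainSAW Ω δ a b) (n : ℕ) :
    {γ' : DomainSAW Ω δ a b | ∃ hw : γ.walk.getVert n ∈ γ'.walk.support,
        γ'.walk.takeUntil (γ.walk.getVert n) hw =
          γ.walk.takeUntil (γ.walk.getVert n) (γ.walk.getVert_mem_support n)} =
      (fun γ' : DomainSAW Ω δ a b ↦
          (γ'.walk.takeUntil (γ'.walk.getVert n) (γ'.walk.getVert_mem_support n)).support) ⁻¹'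
        {(γ.walk.takeUntil (γ.walk.getVert n) (γ.walk.getVert_mem_support n)).support} := by
  ext γ'
  simp only [mem_setOf_eq, mem_preimage, mem_singleton_iff]
  exact exists_takeUntil_eq_iff γ.isPath γ'.isPath (fun _ ↦ rfl) n

/-- **The exploration package of the self-avoiding walk.** On the finite discrete space of SAWs
of `Ω_δ` from `a` to `b`, let `c γ n` be a real "clock" determined by the past `γ[0,n]` (e.g. its
half-plane capacity) and `s ≤ t` two levels. There are: a filtration `𝒢` on `ℕ` (`𝒢 n` =
generated by the support of the past `γ[0,n]`), a bound `M` on all lengths, and the first passage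
indices `σ ≤ τ ≤ M` of the clock above `s`, resp. `t` (cut at `M`), which are `𝒢`-stopping times,
such that: (i) every real map determined by the past `γ[0,n]` is `𝒢 n`-measurable; (ii) **Doob
identity**: for every finite measure `μ` and every real `X`, `μ[X ∣ 𝒢 n]` is a.e. the cylinder
average `(∫_{cyl γ[0,n]} X dμ) / μ(cyl γ[0,n])` — so `n ↦ E_μ[X ∣ γ[0,n]]` is the Doob martingale
of `X`; (iii) pathwise, `σ = k ≤ M` with `c γ k ≥ s` and `c γ j < s` for `j < k` as soon as the
terminal clock `c γ M ≥ s` (and `σ = k < M` forces `c γ k ≥ s`); same for `τ, t`; (iv) a real map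
is measurable for the stopped σ-algebra `𝒢_σ` as soon as on `{σ = k < M}` it is determined by the
past `γ[0,k]`; (v) the past at a step `n ≥ |γ|` is the whole walk. (Duminil-Copin–Smirnov 2012,
Lemma 6.6: the exploration filtration and the conditional-expectation martingale; CDHKS 2014, §3:
first steps of capacity `≥ s, t`.) [cite: DuminilCopinSmirnov2012Clay, Lemma 6.6] -/
theorem exists_explorationFiltration [Finite (DomainSAW Ω δ a b)]
    (c : DomainSAW Ω δ a b → ℕ → ℝ)
    (hc : ∀ (γ γ' : DomainSAW Ω δ a b) (n : ℕ),
      (γ.walk.takeUntil (γ.walk.getVert n) (γ.walk.getVert_mem_support n)).support =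
        (γ'.walk.takeUntil (γ'.walk.getVert n) (γ'.walk.getVert_mem_support n)).support →
      c γ n = c γ' n)
    {s t : ℝ} (hst : s ≤ t) :
    ∃ (𝒢 : Filtration ℕ (inferInstance : MeasurableSpace (DomainSAW Ω δ a b))) (M : ℕ)
      (σ τ : DomainSAW Ω δ a b → WithTop ℕ) (hσ : IsStoppingTime 𝒢 σ),
      IsStoppingTime 𝒢 τ ∧ σ ≤ τ ∧ (∀ γ, τ γ ≤ M) ∧
      (∀ γ : DomainSAW Ω δ a b, γ.walk.length ≤ M) ∧
      (∀ (n : ℕ) (f : DomainSAW Ω δ a b → ℝ),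
        (∀ γ γ' : DomainSAW Ω δ a b,
          (γ.walk.takeUntil (γ.walk.getVert n) (γ.walk.getVert_mem_support n)).support =
            (γ'.walk.takeUntil (γ'.walk.getVert n) (γ'.walk.getVert_mem_support n)).support →
          f γ = f γ') → Measurable[𝒢 n] f) ∧
      (∀ (μ : Measure (DomainSAW Ω δ a b)) [IsFiniteMeasure μ] (X : DomainSAW Ω δ a b → ℝ)
          (n : ℕ),
        μ[X | 𝒢 n] =ᵐ[μ] fun γ ↦
          (∫ x in {γ' : DomainSAW Ω δ a b | ∃ hw : γ.walk.getVert n ∈ γ'.walk.support,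
              γ'.walk.takeUntil (γ.walk.getVert n) hw =
                γ.walk.takeUntil (γ.walk.getVert n) (γ.walk.getVert_mem_support n)}, X x ∂μ) /
            (μ {γ' : DomainSAW Ω δ a b | ∃ hw : γ.walk.getVert n ∈ γ'.walk.support,
              γ'.walk.takeUntil (γ.walk.getVert n) hw =
                γ.walk.takeUntil (γ.walk.getVert n) (γ.walk.getVert_mem_support n)}).toReal) ∧
      (∀ γ, ∃ k : ℕ, σ γ = k ∧ k ≤ M ∧ (s ≤ c γ M → s ≤ c γ k ∧ ∀ j < k, c γ j < s)) ∧
      (∀ γ, ∃ k : ℕ, τ γ = k ∧ k ≤ M ∧ (t ≤ c γ M → t ≤ c γ k ∧ ∀ j < k, c γ j < t)) ∧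
      (∀ (γ : DomainSAW Ω δ a b) (k : ℕ), σ γ = k → k < M → s ≤ c γ k) ∧
      (∀ (γ : DomainSAW Ω δ a b) (k : ℕ), τ γ = k → k < M → t ≤ c γ k) ∧
      (∀ f : DomainSAW Ω δ a b → ℝ,
        (∀ (k : ℕ) (γ γ' : DomainSAW Ω δ a b), σ γ = k → k < M →
          (γ.walk.takeUntil (γ.walk.getVert k) (γ.walk.getVert_mem_support k)).support =
            (γ'.walk.takeUntil (γ'.walk.getVert k) (γ'.walk.getVert_mem_support k)).support →
          f γ = f γ') →
        Measurable[hσ.measurableSpace] f) ∧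
      (∀ (γ : DomainSAW Ω δ a b) (n : ℕ), γ.walk.length ≤ n →
        (γ.walk.takeUntil (γ.walk.getVert n) (γ.walk.getVert_mem_support n)).support =
          γ.walk.support) := by
  classical
  haveI : Fintype (DomainSAW Ω δ a b) := Fintype.ofFinite _
  -- the past-support maps and their combinatorics
  set sig : ℕ → DomainSAW Ω δ a b → List (Site 2) := fun n γ ↦
    (γ.walk.takeUntil (γ.walk.getVert n) (γ.walk.getVert_mem_support n)).support with hsig
  have K2 : ∀ {k n : ℕ}, k ≤ n → ∀ {γ γ' : DomainSAW Ω δ a b}, sig n γ = sig n γ' →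
      sig k γ = sig k γ' :=
    fun hkn γ γ' h ↦ support_takeUntil_getVert_eq_of_le γ.isPath γ'.isPath hkn h
  have K3 : ∀ (γ : DomainSAW Ω δ a b) (n : ℕ), γ.walk.length ≤ n → sig n γ = γ.walk.support :=
    fun γ n hn ↦ support_takeUntil_getVert_of_length_le γ.isPath hn
  set M : ℕ := Finset.univ.sup fun γ : DomainSAW Ω δ a b ↦ γ.walk.length with hM
  have hMlen : ∀ γ : DomainSAW Ω δ a b, γ.walk.length ≤ M := fun γ ↦
    Finset.le_sup (f := fun γ : DomainSAW Ω δ a b ↦ γ.walk.length) (Finset.mem_univ γ)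
  have K4 : ∀ {γ γ' : DomainSAW Ω δ a b}, sig M γ = sig M γ' → γ = γ' := fun {γ γ'} h ↦
    DomainSAW.eq_of_support_takeUntil_eq (hMlen γ) (hMlen γ') h
  -- the filtration generated by the supports of the pasts
  let 𝒢 : Filtration ℕ (inferInstance : MeasurableSpace (DomainSAW Ω δ a b)) :=
    { seq := fun n ↦ MeasurableSpace.comap (sig n) ⊤
      mono' := fun k n hkn ↦ comap_top_le_comap_top_of_forall_eq fun _ _ h ↦ K2 hkn h
      le' := fun n ↦ le_top }
  have h𝒢 : ∀ (n : ℕ) (f : DomainSAW Ω δ a b → ℝ),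
      (∀ γ γ', sig n γ = sig n γ' → f γ = f γ') → Measurable[𝒢 n] f :=
    fun n f hf ↦ measurable_comap_top_of_forall_eq (sig n) fun _ _ h ↦ hf _ _ h
  -- the clock is adapted; first passage indices above a level `r`
  have hcad : Adapted 𝒢 fun n γ ↦ c γ n := fun n ↦ h𝒢 n _ fun γ γ' h ↦ hc γ γ' n h
  let θ : ℝ → DomainSAW Ω δ a b → WithTop ℕ := fun r γ ↦
    ((hittingBtwn (fun n γ ↦ c γ n) (Ici r) 0 M γ : ℕ) : WithTop ℕ)
  have hθst : ∀ r, IsStoppingTime 𝒢 (θ r) := fun r ↦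
    hcad.isStoppingTime_hittingBtwn measurableSet_Ici
  have hθM : ∀ r γ, θ r γ ≤ M := fun r γ ↦ by
    change ((hittingBtwn (fun n γ ↦ c γ n) (Ici r) 0 M γ : ℕ) : WithTop ℕ) ≤ (M : WithTop ℕ)
    exact_mod_cast hittingBtwn_le (u := fun n γ ↦ c γ n) γ
  have hθeq : ∀ r γ (k : ℕ), θ r γ = k ↔ hittingBtwn (fun n γ ↦ c γ n) (Ici r) 0 M γ = k :=
    fun r γ k ↦ by
      change ((hittingBtwn (fun n γ ↦ c γ n) (Ici r) 0 M γ : ℕ) : WithTop ℕ) = (k : WithTop ℕ) ↔ _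
      exact_mod_cast Iff.rfl
  have hθspec : ∀ r γ, ∃ k : ℕ, θ r γ = k ∧ k ≤ M ∧
      (r ≤ c γ M → r ≤ c γ k ∧ ∀ j < k, c γ j < r) := by
    intro r γ
    refine ⟨hittingBtwn (fun n γ ↦ c γ n) (Ici r) 0 M γ, rfl, hittingBtwn_le γ,
      fun hr ↦ ⟨?_, fun j hj ↦ ?_⟩⟩
    · exact hittingBtwn_mem_set (u := fun n γ ↦ c γ n) (s := Ici r) ⟨M, ⟨Nat.zero_le _, le_rfl⟩, hr⟩
    · have h := notMem_of_lt_hittingBtwn (u := fun n γ ↦ c γ n) (s := Ici r) hj (Nat.zero_le j)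
      exact not_le.1 h
  have hθlt : ∀ r γ (k : ℕ), θ r γ = k → k < M → r ≤ c γ k := by
    intro r γ k hk hkM
    rw [hθeq] at hk
    have h := hittingBtwn_mem_set_of_hittingBtwn_lt (u := fun n γ ↦ c γ n) (s := Ici r) (ω := γ)
      (m := M) (by rw [hk]; exact hkM)
    rwa [hk] at h
  -- `{θ = k}` and the values of a past-determined map on it are functions of the past `γ[0,k]`
  have hθsat : ∀ r (k : ℕ) ⦃γ γ' : DomainSAW Ω δ a b⦄, θ r γ = k → sig k γ = sig k γ' →
      θ r γ' = k := by
    intro r k γ γ' hk h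
    rcases lt_or_ge k M with hkM | hkM
    · rw [hθeq] at hk ⊢
      exact hittingBtwn_eq_of_forall_le_eq (u := fun n γ ↦ c γ n) (s := Ici r)
        (fun j hj ↦ hc γ γ' j (K2 hj h)) hk hkM
    · have hkM' : k ≤ M := by
        have h1 := hθM r γ
        rw [hk] at h1
        exact_mod_cast h1
      have hkM'' : k = M := le_antisymm hkM' hkM
      subst hkM''
      rwa [← K4 h]
  refine ⟨𝒢, M, θ s, θ t, hθst s, hθst t, fun γ ↦ ?_, hθM t, hMlen, h𝒢, fun μ _ X n ↦ ?_,
    hθspec s, hθspec t, hθlt s, hθlt t, fun f hf ↦ ?_, K3⟩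
  · -- `σ ≤ τ`
    change ((hittingBtwn (fun n γ ↦ c γ n) (Ici s) 0 M γ : ℕ) : WithTop ℕ) ≤
      ((hittingBtwn (fun n γ ↦ c γ n) (Ici t) 0 M γ : ℕ) : WithTop ℕ)
    exact_mod_cast hittingBtwn_anti (fun n γ ↦ c γ n) 0 M (Ici_subset_Ici.2 hst) γ
  · -- the Doob identity
    have h := condExp_comap_top_ae_eq (μ := μ) (Y := sig n) le_top (Integrable.of_finite (f := X))
    refine h.trans (Filter.EventuallyEq.of_eq ?_)
    funext γ
    rw [DomainSAW.setOf_exists_takeUntil_eq γ n, div_eq_inv_mul, measureReal_def]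
  · -- measurability for the stopped σ-algebra
    refine measurable_stoppedSigma_of_saturated (hθst s) (DomainSAW.measurable_of_top f) sig
      (fun k S hS ↦ (measurableSet_comap_top_iff (sig k) S).2 hS) (hθsat s) ?_
    intro k γ γ' hk h
    rcases lt_or_ge k M with hkM | hkM
    · exact hf k γ γ' hk hkM h
    · have hkM' : k ≤ M := by
        have h1 := hθM s γ
        rw [hk] at h1
        exact_mod_cast h1
      have hkM'' : k = M := le_antisymm hkM' hkM
      subst hkM''
      rw [K4 h]

end SAWs

end Literature.Probability.RandomPlanarGeometry.SAW

end
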